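import Literature.NumberTheory.GelbartRogawski1991.WeilLiftNonsplitPrincipalSeriesConstituent
import Literature.NumberTheory.Rogawski1990.XiLocalCharacter
import Literature.NumberTheory.Automorphic.Liu2021.CheckOfChiLocalPlace
import Literature.NumberTheory.Automorphic.Liu2021.FinAdelicCheckSurjective
import Literature.NumberTheory.Automorphic.ConjugateSelfDualLocalValues
import Literature.NumberTheory.Automorphic.IdeleClassCharacterConjugate
import Literature.NumberTheory.GelbartRogawski1991.UnitaryDualPairThetaKernelCM
import Literature.NumberTheory.Automorphic.AnisotropicUnitaryGroupCompactOfPlace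
import Literature.NumberTheory.Automorphic.UnitaryGroupNonsplitPlace
import HarnessLib

/-!
# Crux `H413` · programme P2 · U′-N pay-down (`Lines/F0_P2GR91NJacquet.lean`) — STUB **K2** CLOSED: THE DICTIONARY ALGEBRA
# `stubDictTorusChar_holds : ‹StubDictTorusChar›` — under the two DICTIONARY hypotheses of letter #76 the endoscopic datum `ξ = (η, ψ)` and
# Rogawski's `μω` ELIMINATE from the inducing character: `χ_ξ = χθ := cmXiTorusChar L v μ_v ψθ⁻¹ ψθ`

Cell hodgecm-mathlib (D-0151), FLOOR 0, crux item H413 = stmt-HodgeConjecture-24833; pay-down sub-line of print letter #76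
`GR91Lemma512NonsplitAsPrinted` (`Cruxes/H413/Lines/F0_P2GR91NJacquet.lean`, F0P2-plan (g7) CUT 2026-08-31T14:14Z, bytes 8624ae7daed8e64a, design memo
`F0/P2/F0_P2GR91NJacquet.design.F0P2-plan-g7.md` §2; director s561 (4)); registered stub `stub_dictionary_torusChar : StubDictTorusChar`.  Author F0P2-p02 (g5).
THEOREMS ONLY (no `def`, no instance, no notation, no named fact, no `sorry`); kernel lane `--supports stmt-HodgeConjecture-24833 --as helper`; never imports a
`Cruxes/…/Lines` module — the registered text is PASTED VERBATIM as the type, with the sub-line's one Lines-local Prop `CenterCharSpec L μ χf ε v ψθ` δ-UNFOLDED to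
its body (so the fold `stub_dictionary_torusChar := F0P2oStubDictTorusChar.stubDictTorusChar_holds` elaborates by `rfl`-unfolding).  HONEST LABEL: HC_CM is proved
only modulo the printed citations until rung 0 closes; this file discharges no printed citation and introduces none.

THE STATEMENT (K2).  For a CM field `L`, `ξ = (η, ψ) ∈ OneDimAutRepH L`, Rogawski's unitary `μω` with `μω|_{𝕀_{L⁺}} = ω_{L/L⁺}`, a conjugate-symplectic `μ` and a
continuous unitary `χ_f` on `U(1)(𝔸_{L⁺,f})` satisfying DICTIONARY (μ) `μ̃_v = (η̃⁻¹ ψ̃⁻¹ μω)_v` (every finite `v`) and DICTIONARY (χ_f)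
`χ_f(z/z̄) = (ψ̃⁻¹ · (η̃⁻¹ ψ̃⁻¹ μω)²)(z)` (every finite idèle `z` of `L`): at every NON-SPLIT `v`, for every line class `ε` and every character `ψθ` of `E¹_v`
with the CENTRE-CHARACTER constraint «`ψθ(det u) = χ_{f,v}(u) · μ_v(det u)⁻¹` on `U((ε))(L⁺_v)`» (= `CenterCharSpec`),
`cmXiTorusChar L v μω_v η_v ψ_v = cmXiTorusChar L v μ_v ψθ⁻¹ ψθ` (★ `cmXiTorusChar` = Keys–Rogawski `χ_ξ(d(α,β,ᾱ⁻¹)) = η₁(α/ᾱ)·m(α)·‖α‖^{1/2}·η₂(det)`).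

THE PROOF (design memo §2, every input ★):
* §1 DICTIONARY (μ) at one unit: `μ_v(α) = η_v(α/ᾱ) · ψ_v(α/ᾱ) · μω_v(α)` (★ `cm_pullback_semilocalComponent`: `η̃_v(a) = η_v(a/ā)⁻¹`).
* §2 the finite idèle `∏_{w∣v} single_w(x_w)` of the non-split bookkeeping IS `semilocalUnits v x` (★ `localUnits = inr ∘ single`).
* §3 conjugate self-duality: `μ_v(x/x̄) = μ_v(x)²` (★ `IsConjugateSymplectic.toHeckeCharacter_galConj_complexConj`, ★ `smul_semilocalUnits`).
* §4 `det θ(z) = z` for the scalar `θ(z) ∈ U((ε))(L⁺_v)` of the standing data at `v` (★ `LemD1OfPlace.theta`, ★ `localDet`, ★ `localPiEquiv`).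
* §5 LOCAL HILBERT 90 at a non-split `v`: every `β ∈ E¹_v` is `x/x̄` (★ `exists_ne_zero_mul_galAdicCompletionMap_eq`).
* §6 the head: for `β = x/x̄`, `CenterCharSpec` at `θ(x/x̄)` reads `ψθ(x/x̄) = χ_{f,v}(θ(x/x̄)) · μ_v(x/x̄)⁻¹`; ★ `finAdelicCheck_prod_unitsMap_finiteAdeleSingle`
  (Liu's `χ̌` bookkeeping) turns `χ_{f,v}(θ(x/x̄))` into `χ_f((∏_w single_w x_w)/conj)`, which DICTIONARY (χ_f) + §2 + §1 + §3 evaluate to `ψ_v(x/x̄) · μ_v(x/x̄)`;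
  hence `ψθ = ψ_v` on `E¹_v` (§5), and with §1 both sides of K2 unfold (★ `xiTorusChar_apply`) to `η_v(α/ᾱ) · μω_v(α) · ‖α‖^{1/2} · ψ_v(det t)`.

## References
* [GelbartRogawski1991] S. Gelbart, J. Rogawski, *L-functions and Fourier–Jacobi coefficients for the unitary group U(3)*, Invent. Math. 105 (1991), §5.1 (5.1.1) p. 465,
  Lemma 5.1.2 pp. 465–466.
* [Rogawski1990] J. Rogawski, *Automorphic Representations of Unitary Groups in Three Variables*, Ann. of Math. Stud. 123 (1990), §12.1 p. 172, §12.2 (2) p. 174.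
* [Liu2021] Y. Liu, Camb. J. Math. 9 (2021) = arXiv:2102.11518, Def. 4.1, Remark 4.2, App. D §D.1 (l. 5221–5224).
* [CasselsFrohlichANT1967] Cassels–Fröhlich (eds.), *Algebraic Number Theory* (1967), Ch. V §2.7 Prop. 5, Ch. VI §1.7 (Hilbert 90); Ch. VII (Tate) §3.2, §4.3.
-/

set_option autoImplicit false
set_option linter.dupNamespace false

noncomputable section

open NumberField IsDedekindDomain MeasureTheory
open scoped Matrix

open Literature.NumberTheory Literature.NumberTheory.Automorphic Literature.NumberTheory.Automorphic.UnitaryGroup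
open Literature.NumberTheory.Automorphic.IdeleClassGroup
open Literature.NumberTheory.Automorphic.Liu2021 Literature.NumberTheory.Automorphic.Liu2021.Def411WeilCarriers
open Literature.NumberTheory.GaloisRepresentations
open Literature.NumberTheory.Rogawski1990
open Literature.NumberTheory.GelbartRogawski1991 Literature.NumberTheory.GelbartRogawski1991.UnitaryDualPair

namespace Summit.HodgeConjecture.HodgeConjecture.Cruxes.H413.F0P2oStubDictTorusChar

/-! ## §1 DICTIONARY (μ) pointwise: `μ_v(α) = η_v(α/ᾱ) · ψ_v(α/ᾱ) · μω_v(α)` -/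

/-- DICTIONARY (μ) read at one unit `α ∈ (L ⊗ L⁺_v)ˣ` through ★ `cm_pullback_semilocalComponent` (`bcη_v(a) = η_v(a/ā)⁻¹`):
`μ_v(α) = η_v(α/ᾱ) · ψ_v(α/ᾱ) · μω_v(α)`. [cite: Rogawski1990, §12.1 p. 172, §12.2 (2) p. 174] -/
theorem semilocalComponent_mu_apply (L : Type) [Field L] [NumberField L] [IsCMField L]
    (ξ : OneDimAutRepH L) (μω : HeckeCharacter L) (μ : Literature.NumberTheory.Automorphic.IdeleClassGroup L →ₜ* Circle)
    (v : HeightOneSpectrum (𝓞 ↥(maximalRealSubfield L)))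
    (hdμ : (toHeckeCharacter L μ).semilocalComponent L v = (ξ.bcη⁻¹ * ξ.bcψ⁻¹ * μω).semilocalComponent L v)
    (α : (UnitaryGroup.LocalRing L v)ˣ) :
    (toHeckeCharacter L μ).semilocalComponent L v α =
      torusLocalComponent L (IsCMField.complexConj L) v ξ.η
          (quotConj (conjLocal L (IsCMField.complexConj L) v) (conjLocal_conjLocal_cm L v) α) *
        torusLocalComponent L (IsCMField.complexConj L) v ξ.ψ
          (quotConj (conjLocal L (IsCMField.complexConj L) v) (conjLocal_conjLocal_cm L v) α) *
        μω.semilocalComponent L v α := by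
  have h := DFunLike.congr_fun hdμ α
  have hη : ξ.bcη.semilocalComponent L v α = (torusLocalComponent L (IsCMField.complexConj L) v ξ.η
      (quotConj (conjLocal L (IsCMField.complexConj L) v) (conjLocal_conjLocal_cm L v) α))⁻¹ :=
    cm_pullback_semilocalComponent L ξ.η ξ.hη α
  have hψ : ξ.bcψ.semilocalComponent L v α = (torusLocalComponent L (IsCMField.complexConj L) v ξ.ψ
      (quotConj (conjLocal L (IsCMField.complexConj L) v) (conjLocal_conjLocal_cm L v) α))⁻¹ :=
    cm_pullback_semilocalComponent L ξ.ψ ξ.hψ α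
  rw [semilocalComponent_apply] at hη hψ
  rw [h, semilocalComponent_apply, HeckeCharacter.mul_apply, HeckeCharacter.mul_apply, HeckeCharacter.inv_apply,
    HeckeCharacter.inv_apply, hη, hψ, inv_inv, inv_inv, semilocalComponent_apply]

/-! ## §2 Idèle bookkeeping at `v`: the finite idèle `∏_{w ∣ v} single_w(x_w)` is the semi-local unit `semilocalUnits v x` -/

/-- `(1_∞, ∏_{w ∣ v} single_w(x_w)) = semilocalUnits v x` in `𝕀_L` (★ `localUnits w = inr ∘ single_w`, ★ `semilocalUnits_apply`).
[cite: TateThesis1967, §3.2] -/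
theorem unitsMap_inr_prod_finiteAdeleSingle (L : Type) [Field L] [NumberField L] [IsCMField L]
    (v : HeightOneSpectrum (𝓞 ↥(maximalRealSubfield L))) (x : (UnitaryGroup.LocalRing L v)ˣ) :
    Units.map (N := AdeleRing (𝓞 L) L) (MonoidHom.inr (InfiniteAdeleRing L) (FiniteAdeleRing (𝓞 L) L))
        (∏ w : UnitaryGroup.PlacesOver L v,
          Units.map (finiteAdeleSingle w.1) (Units.map (Pi.evalRingHom _ w).toMonoidHom x)) =
      semilocalUnits L v x := by
  rw [semilocalUnits_apply, map_prod]
  rfl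

/-! ## §3 Conjugate self-duality: `μ_v(x/x̄) = μ_v(x)²` -/

/-- For a conjugate-symplectic `μ` (★ conjugate self-dual: `μ̃(c • y) = μ̃(y)⁻¹`, ★ `IsConjugateSymplectic.toHeckeCharacter_galConj_complexConj`)
and `x ∈ (L ⊗ L⁺_v)ˣ`: `μ_v(x / x̄) = μ_v(x) · μ_v(x)` (★ `smul_semilocalUnits`: `c • semilocalUnits x = semilocalUnits x̄`).
[cite: Liu2021, Def. 4.1, Remark 4.2] -/
theorem semilocalComponent_mu_quotConj (L : Type) [Field L] [NumberField L] [IsCMField L]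
    (μ : Literature.NumberTheory.Automorphic.IdeleClassGroup L →ₜ* Circle) (hμ : IsConjugateSymplectic L μ)
    (v : HeightOneSpectrum (𝓞 ↥(maximalRealSubfield L))) (x : (UnitaryGroup.LocalRing L v)ˣ) :
    (toHeckeCharacter L μ).semilocalComponent L v
        ((quotConj (conjLocal L (IsCMField.complexConj L) v) (conjLocal_conjLocal_cm L v) x :
            ↥(normOneUnits (conjLocal L (IsCMField.complexConj L) v))) : (UnitaryGroup.LocalRing L v)ˣ) =
      (toHeckeCharacter L μ).semilocalComponent L v x * (toHeckeCharacter L μ).semilocalComponent L v x := by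
  have hconj : (toHeckeCharacter L μ).semilocalComponent L v
      (Units.map (conjLocal L (IsCMField.complexConj L) v : UnitaryGroup.LocalRing L v →* UnitaryGroup.LocalRing L v) x) =
        ((toHeckeCharacter L μ).semilocalComponent L v x)⁻¹ := by
    rw [semilocalComponent_apply, semilocalComponent_apply, ← smul_semilocalUnits L (IsCMField.complexConj L) x,
      ← HeckeCharacter.galConj_apply, ← toHeckeCharacter_galConj, hμ.toHeckeCharacter_galConj_complexConj,
      HeckeCharacter.inv_apply]
  rw [coe_quotConj, map_mul, map_inv, hconj, inv_inv]

/-! ## §4 The centre character read at `θ(x/x̄)`: determinant and the DICTIONARY (χ_f) idèle -/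

section Theta

variable (L : Type) [Field L] [NumberField L] [IsCMField L] (v : HeightOneSpectrum (𝓞 ↥(maximalRealSubfield L)))

/-- A purely imaginary unit `δ = imagUnit L` for the standing data (`c δ = −δ`). [cite: Liu2021, App. D §D.1 Step 1] -/
private theorem hcδ' : IsCMField.complexConj L (imagUnit L) = -imagUnit L := complexConj_imagUnit L

/-- `(1 : M₂(L))` is hermitian for `c ⊗ ᵀ`. [folklore] -/
private theorem one_map_transpose : ((1 : Matrix (Fin 2) (Fin 2) L).map (IsCMField.complexConj L))ᵀ = 1 := by
  rw [Matrix.map_one (IsCMField.complexConj L) (map_zero _) (map_one _), Matrix.transpose_one]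

omit [IsCMField L] in
/-- `det (1 : M₂(L)) ≠ 0`. [folklore] -/
private theorem one_det_ne_zero : (1 : Matrix (Fin 2) (Fin 2) L).det ≠ 0 := by
  rw [Matrix.det_one]; exact one_ne_zero

/-- **`det (θ z) = z`**: the determinant (★ `localDet`) of the scalar `θ z = (z) ∈ U(J₁)(L⁺_v)` (★ `theta`, read through ★ `localPiEquiv`)
is `z` itself. [cite: Mok2014, §1 Notation p. 5] -/
theorem coe_localDet_localPiEquiv_theta {J₁ : Matrix (Fin 1) (Fin 1) L} (hJ₁ : IsUnit J₁.det)
    (z : (LemD1OfPlace.standingData L v (IsCMField.complexConj L) 2 (1 : Matrix (Fin 2) (Fin 2) L) (hcδ' L) (imagUnit_ne_zero L)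
      le_rfl (one_map_transpose L) (one_det_ne_zero L)).normOne) :
    ((localDet (IsCMField.complexConj L) v hJ₁
        (localPiEquiv L (IsCMField.complexConj L) 1 J₁ v
          (LemD1OfPlace.theta L v (IsCMField.complexConj L) 2 (1 : Matrix (Fin 2) (Fin 2) L) (hcδ' L) (imagUnit_ne_zero L)
            le_rfl (one_map_transpose L) (one_det_ne_zero L) J₁ z)) :
          ↥(normOneUnits (conjLocal L (IsCMField.complexConj L) v))) : (UnitaryGroup.LocalRing L v)ˣ) =
      (z : (UnitaryGroup.LocalRing L v)ˣ) := by
  rw [coe_localDet, coe_localPiEquiv_apply, LemD1OfPlace.coe_theta, ContinuousMulEquiv.symm_apply_apply]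
  refine Units.ext ?_
  rw [Matrix.GeneralLinearGroup.val_det_apply, Matrix.det_fin_one, Literature.RepresentationTheory.Liu2021.OscillatorStandingData.coe_unitScalar,
    Matrix.scalar_apply, Matrix.diagonal_apply_eq]

end Theta

/-! ## §5 Local Hilbert 90 at a non-split place: every norm-one unit of `L ⊗ L⁺_v` is a quotient `x / x̄` -/

/-- **Hilbert 90 for `E¹_v` at a NON-SPLIT `v`**: every `β ∈ (L ⊗ L⁺_v)ˣ` with `β̄ β = 1` is `quotConj x = x · x̄⁻¹` for some unit `x`
(★ `exists_ne_zero_mul_galAdicCompletionMap_eq`: field H90 for the involution `c_w` of `L_w`, `w` the unique place over `v`).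
[cite: CasselsFrohlichANT1967, Ch. V §2.7 Prop. 5; Ch. VI §1.7] -/
theorem exists_quotConj_eq_of_nonsplit (L : Type) [Field L] [NumberField L] [IsCMField L]
    (v : HeightOneSpectrum (𝓞 ↥(maximalRealSubfield L))) (hv : ∀ w : UnitaryGroup.PlacesOver L v, IsCMField.complexConj L • w.1 = w.1)
    (β : ↥(normOneUnits (conjLocal L (IsCMField.complexConj L) v))) :
    ∃ x : (UnitaryGroup.LocalRing L v)ˣ, quotConj (conjLocal L (IsCMField.complexConj L) v) (conjLocal_conjLocal_cm L v) x = β := by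
  have hc : IsCMField.complexConj L ≠ 1 := IsCMField.complexConj_ne_one (K := L)
  have hcc : IsCMField.complexConj L * IsCMField.complexConj L = 1 :=
    AlgEquiv.ext fun x => by rw [AlgEquiv.mul_apply, IsCMField.complexConj_apply_apply, AlgEquiv.one_apply]
  -- componentwise norm-one relation `β_w · c_w(β_w) = 1`
  have hβ : ∀ w : UnitaryGroup.PlacesOver L v,
      ((β : (UnitaryGroup.LocalRing L v)ˣ) : UnitaryGroup.LocalRing L v) w *
          galAdicCompletionMap (L := L) (IsCMField.complexConj L) (hv w) (((β : (UnitaryGroup.LocalRing L v)ˣ) : UnitaryGroup.LocalRing L v) w) = 1 := by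
    intro w
    have h := congrFun ((mem_normOneUnits_iff (β : (UnitaryGroup.LocalRing L v)ˣ)).1 β.2) w
    rw [Pi.mul_apply, Pi.one_apply, conjLocal_apply_eq_of_smul_eq (IsCMField.complexConj L) hc v w (hv w)] at h
    rwa [mul_comm] at h
  -- field H90 at every (i.e. the) place over `v`
  choose s hs0 hs _ using fun w : UnitaryGroup.PlacesOver L v =>
    exists_ne_zero_mul_galAdicCompletionMap_eq (↥(maximalRealSubfield L)) L (IsCMField.complexConj L) hcc hc (hv w) (hβ w)
  refine ⟨MulEquiv.piUnits.symm fun w => Units.mk0 (s w) (hs0 w), Subtype.ext (Units.ext (funext fun w => ?_))⟩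
  have hcs0 : galAdicCompletionMap (L := L) (IsCMField.complexConj L) (hv w) (s w) ≠ 0 :=
    (map_ne_zero_iff _ (galAdicCompletionMap (L := L) (IsCMField.complexConj L) (hv w)).injective).2 (hs0 w)
  rw [coe_quotConj, Units.val_mul, Pi.mul_apply, Units.val_inv_eq_inv_val, Pi.inv_apply, Units.coe_map, MonoidHom.coe_coe,
    conjLocal_apply_eq_of_smul_eq (IsCMField.complexConj L) hc v w (hv w)]
  change s w * (galAdicCompletionMap (L := L) (IsCMField.complexConj L) (hv w) (s w))⁻¹ =
    ((β : (UnitaryGroup.LocalRing L v)ˣ) : UnitaryGroup.LocalRing L v) w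
  rw [mul_inv_eq_iff_eq_mul₀ hcs0]
  exact (hs w).symm

/-- `a⁻¹ · (b a c) · d · e = b c · d · e` in a commutative group (bookkeeping for the final character identity). [folklore] -/
private theorem inv_mul_swap_aux {G : Type*} [CommGroup G] (a b c d e : G) :
    a⁻¹ * (b * a * c) * d * e = b * c * d * e := by
  rw [mul_right_comm b a c, mul_comm (b * c) a, inv_mul_cancel_left]

set_option synthInstance.maxHeartbeats 400000 in
set_option maxHeartbeats 8000000 in
/-- **K2 HOLDS — under DICTIONARY (μ) and DICTIONARY (χ_f), `χ_ξ = cmXiTorusChar L v μ_v ψθ⁻¹ ψθ` at every non-split `v` for every `ψθ` with the centre-character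
constraint.**  Type = the body of `F0P2GR91NJacquet.StubDictTorusChar` VERBATIM with `CenterCharSpec L μ χf ε v ψθ` δ-unfolded to its body (the sub-line folds
`stub_dictionary_torusChar := F0P2oStubDictTorusChar.stubDictTorusChar_holds`).  Proof: §5 (Hilbert 90) + §6 of the module docstring.
[cite: GelbartRogawski1991, §5.1 (5.1.1) p. 465, Lem. 5.1.2 pp. 465–466] [cite: Rogawski1990, §12.1 p. 172, §12.2 (2) p. 174] [cite: Liu2021, Def. 4.1, App. D §D.1 (l. 5221–5224)] -/
theorem stubDictTorusChar_holds :
    ∀ (L : Type) [Field L] [NumberField L] [IsCMField L]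
      (ξ : OneDimAutRepH L) (μω : HeckeCharacter L) (hμu : μω.IsUnitary),
      (∀ x : Literature.NumberTheory.GaloisRepresentations.ideleGroup ↥(maximalRealSubfield L),
          μω (AdeleRing.ideleBaseChange (↥(maximalRealSubfield L)) L x) = quadraticHeckeCharCM L x) →
      ∀ (μ : Literature.NumberTheory.Automorphic.IdeleClassGroup L →ₜ* Circle) (hμ : IsConjugateSymplectic L μ)
        (χf : UnitaryGroup.finAdelicOne (↥(maximalRealSubfield L)) L (IsCMField.complexConj L) →* ℂˣ),
        Continuous χf → (∀ z, ‖((χf z : ℂˣ) : ℂ)‖ = 1) →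
        -- DICTIONARY (μ): `μ̃ = η̃⁻¹ · ψ̃⁻¹ · μω`, semi-locally at every finite place of `L⁺`
        (∀ v : HeightOneSpectrum (𝓞 ↥(maximalRealSubfield L)),
            (toHeckeCharacter L μ).semilocalComponent L v = (ξ.bcη⁻¹ * ξ.bcψ⁻¹ * μω).semilocalComponent L v) →
        -- DICTIONARY (χ_f): `χ_f (z / z̄) = (ψ̃⁻¹ · (η̃⁻¹ ψ̃⁻¹ μω)²) ((1_∞, z))` for every finite idèle `z` of `L` (sign forced by the ★ split model)
        (∀ z : (FiniteAdeleRing (𝓞 L) L)ˣ,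
            χf (finAdelicCheck (↥(maximalRealSubfield L)) L (IsCMField.complexConj L)
                (AlgEquiv.ext fun x => by rw [AlgEquiv.mul_apply, IsCMField.complexConj_apply_apply, AlgEquiv.one_apply]) z) =
              (ξ.bcψ⁻¹ * (ξ.bcη⁻¹ * ξ.bcψ⁻¹ * μω) ^ 2)
                (Units.map (N := AdeleRing (𝓞 L) L) (MonoidHom.inr (InfiniteAdeleRing L) (FiniteAdeleRing (𝓞 L) L)) z)) →
        ∀ (v : HeightOneSpectrum (𝓞 ↥(maximalRealSubfield L))),
          (∀ w : PlacesOver L v, IsCMField.complexConj L • w.1 = w.1) →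
          ∀ (ε : (↥(maximalRealSubfield L))ˣ) (ψθ : ↥(normOneUnits (conjLocal L (IsCMField.complexConj L) v)) →* ℂˣ), (∀ u : ↥(localPi L (IsCMField.complexConj L) 1 (JW (↥(maximalRealSubfield L)) L ε) v), ψθ (localDet (IsCMField.complexConj L) v (isUnit_iff_ne_zero.mpr (by rw [Matrix.det_fin_one]; exact JW_apply_ne_zero (↥(maximalRealSubfield L)) L ε)) (localPiEquiv L (IsCMField.complexConj L) 1 (JW (↥(maximalRealSubfield L)) L ε) v u)) = localCharOfCenter (↥(maximalRealSubfield L)) L (IsCMField.complexConj L) (JW (↥(maximalRealSubfield L)) L ε) (JW_apply_ne_zero (↥(maximalRealSubfield L)) L ε) χf v u * ((toHeckeCharacter L μ).semilocalComponent L v ((localDet (IsCMField.complexConj L) v (isUnit_iff_ne_zero.mpr (by rw [Matrix.det_fin_one]; exact JW_apply_ne_zero (↥(maximalRealSubfield L)) L ε)) (localPiEquiv L (IsCMField.complexConj L) 1 (JW (↥(maximalRealSubfield L)) L ε) v u) : ↥(normOneUnits (conjLocal L (IsCMField.complexConj L) v))) : (UnitaryGroup.LocalRing L v)ˣ))⁻¹)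 →
            cmXiTorusChar L v (μω.semilocalComponent L v) (torusLocalComponent L (IsCMField.complexConj L) v ξ.η) (torusLocalComponent L (IsCMField.complexConj L) v ξ.ψ) =
              cmXiTorusChar L v ((toHeckeCharacter L μ).semilocalComponent L v) ψθ⁻¹ ψθ := by
  intro L _ _ _ ξ μω hμu hquad μ hμ χf hcont hunit hdμ hdχ v hv ε ψθ hspec
  have hc : IsCMField.complexConj L ≠ 1 := IsCMField.complexConj_ne_one (K := L)
  have hcc : IsCMField.complexConj L * IsCMField.complexConj L = 1 :=
    AlgEquiv.ext fun x => by rw [AlgEquiv.mul_apply, IsCMField.complexConj_apply_apply, AlgEquiv.one_apply]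
  -- (B) `ψθ = ψ_v` on the whole local norm-one torus
  have hB : ∀ β : ↥(normOneUnits (conjLocal L (IsCMField.complexConj L) v)),
      ψθ β = torusLocalComponent L (IsCMField.complexConj L) v ξ.ψ β := by
    intro β
    obtain ⟨x, rfl⟩ := exists_quotConj_eq_of_nonsplit L v hv β
    -- the scalar `θ(x/x̄) ∈ U((ε))(L⁺_v)` of the standing data at `v` (rank 2, Gram `1`, `δ = imagUnit L`)
    have h1 := hspec (LemD1OfPlace.theta L v (IsCMField.complexConj L) 2 (1 : Matrix (Fin 2) (Fin 2) L) (hcδ' L) (imagUnit_ne_zero L) le_rfl (one_map_transpose L) (one_det_ne_zero L) (JW (↥(maximalRealSubfield L)) L ε) ((LemD1OfPlace.standingData L v (IsCMField.complexConj L) 2 (1 : Matrix (Fin 2) (Fin 2) L) (hcδ' L) (imagUnit_ne_zero L) le_rfl (one_map_transpose L) (one_det_ne_zero L)).divConj x))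
    -- `det (θ(x/x̄)) = x/x̄`
    have hdet : localDet (IsCMField.complexConj L) v
        (isUnit_iff_ne_zero.mpr (by rw [Matrix.det_fin_one]; exact JW_apply_ne_zero (↥(maximalRealSubfield L)) L ε))
        (localPiEquiv L (IsCMField.complexConj L) 1 (JW (↥(maximalRealSubfield L)) L ε) v (LemD1OfPlace.theta L v (IsCMField.complexConj L) 2 (1 : Matrix (Fin 2) (Fin 2) L) (hcδ' L) (imagUnit_ne_zero L) le_rfl (one_map_transpose L) (one_det_ne_zero L) (JW (↥(maximalRealSubfield L)) L ε) ((LemD1OfPlace.standingData L v (IsCMField.complexConj L) 2 (1 : Matrix (Fin 2) (Fin 2) L) (hcδ' L) (imagUnit_ne_zero L) le_rfl (one_map_transpose L) (one_det_ne_zero L)).divConj x))) =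
        quotConj (conjLocal L (IsCMField.complexConj L) v) (conjLocal_conjLocal_cm L v) x := by
      apply Subtype.ext
      rw [coe_localDet_localPiEquiv_theta L v _ ((LemD1OfPlace.standingData L v (IsCMField.complexConj L) 2 (1 : Matrix (Fin 2) (Fin 2) L) (hcδ' L) (imagUnit_ne_zero L) le_rfl (one_map_transpose L) (one_det_ne_zero L)).divConj x), coe_quotConj,
        Literature.RepresentationTheory.Liu2021.OscillatorStandingData.coe_divConj, div_eq_mul_inv]
      rfl
    rw [hdet] at h1
    -- the centre character at `θ(x/x̄)` is `χf (∏_w single_w(x_w) / conj)` (★ `finAdelicCheck_prod_unitsMap_finiteAdeleSingle`)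
    have h2 : localCharOfCenter (↥(maximalRealSubfield L)) L (IsCMField.complexConj L) (JW (↥(maximalRealSubfield L)) L ε)
          (JW_apply_ne_zero (↥(maximalRealSubfield L)) L ε) χf v (LemD1OfPlace.theta L v (IsCMField.complexConj L) 2 (1 : Matrix (Fin 2) (Fin 2) L) (hcδ' L) (imagUnit_ne_zero L) le_rfl (one_map_transpose L) (one_det_ne_zero L) (JW (↥(maximalRealSubfield L)) L ε) ((LemD1OfPlace.standingData L v (IsCMField.complexConj L) 2 (1 : Matrix (Fin 2) (Fin 2) L) (hcδ' L) (imagUnit_ne_zero L) le_rfl (one_map_transpose L) (one_det_ne_zero L)).divConj x)) =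
        χf (finAdelicCheck (↥(maximalRealSubfield L)) L (IsCMField.complexConj L) hcc
          (∏ w : UnitaryGroup.PlacesOver L v,
            Units.map (finiteAdeleSingle w.1) (Units.map (Pi.evalRingHom _ w).toMonoidHom x))) := by
      rw [localCharOfCenter_apply,
        CheckOfChi.finAdelicCheck_prod_unitsMap_finiteAdeleSingle hcc (hcδ' L) (imagUnit_ne_zero L) le_rfl (one_map_transpose L)
          (one_det_ne_zero L) (JW_apply_ne_zero (↥(maximalRealSubfield L)) L ε) x]
      rfl
    -- DICTIONARY (χ_f) at that finite idèle, read on `semilocalUnits v x`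
    have h3 := hdχ (∏ w : UnitaryGroup.PlacesOver L v,
      Units.map (finiteAdeleSingle w.1) (Units.map (Pi.evalRingHom _ w).toMonoidHom x))
    rw [unitsMap_inr_prod_finiteAdeleSingle L v x] at h3
    have hψx : ξ.bcψ (semilocalUnits L v x) = (torusLocalComponent L (IsCMField.complexConj L) v ξ.ψ
        (quotConj (conjLocal L (IsCMField.complexConj L) v) (conjLocal_conjLocal_cm L v) x))⁻¹ := by
      have h := cm_pullback_semilocalComponent L ξ.ψ ξ.hψ x
      rw [semilocalComponent_apply] at h
      exact h
    have hμx : (ξ.bcη⁻¹ * ξ.bcψ⁻¹ * μω) (semilocalUnits L v x) = (toHeckeCharacter L μ).semilocalComponent L v x := by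
      rw [← semilocalComponent_apply, ← hdμ v]
    have h4 : (ξ.bcψ⁻¹ * (ξ.bcη⁻¹ * ξ.bcψ⁻¹ * μω) ^ 2) (semilocalUnits L v x) =
        torusLocalComponent L (IsCMField.complexConj L) v ξ.ψ
            (quotConj (conjLocal L (IsCMField.complexConj L) v) (conjLocal_conjLocal_cm L v) x) *
          (toHeckeCharacter L μ).semilocalComponent L v
            ((quotConj (conjLocal L (IsCMField.complexConj L) v) (conjLocal_conjLocal_cm L v) x :
                ↥(normOneUnits (conjLocal L (IsCMField.complexConj L) v))) : (UnitaryGroup.LocalRing L v)ˣ) := by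
      rw [HeckeCharacter.mul_apply, HeckeCharacter.pow_apply, HeckeCharacter.inv_apply, hψx, inv_inv, hμx,
        semilocalComponent_mu_quotConj L μ hμ v x, sq]
    -- the finite idèle of the dictionary IS the one of `h2` (same `hcc` up to proof irrelevance)
    rw [h1, h2]
    erw [h3]
    rw [h4, mul_inv_cancel_right]
  -- (C) both characters of `T(L⁺_v)` agree
  refine MonoidHom.ext fun t => ?_
  unfold cmXiTorusChar
  rw [xiTorusChar_apply, xiTorusChar_apply, MonoidHom.inv_apply, hB, hB,
    semilocalComponent_mu_apply L ξ μω μ v (hdμ v)]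
  -- `ψ(q)⁻¹ · (η(q) ψ(q) μω(α)) · h · ψ(det) = η(q) · μω(α) · h · ψ(det)` in the commutative group `ℂˣ`
  exact (inv_mul_swap_aux _ _ _ _ _).symm

end Summit.HodgeConjecture.HodgeConjecture.Cruxes.H413.F0P2oStubDictTorusChar

end
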